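import Summits.RiemannHypothesis.RiemannHypothesis.Theorems.JensenLogBandArcDen2
import Summits.RiemannHypothesis.RiemannHypothesis.Theorems.JensenLogBandArcLambda3Sharp
import HarnessLib

/-!
# `‖D″‖ = O(1/T²) + O(n/T³)` on the window (BAND line, S4b input — sharp form)

RH ladder column JENSEN, rung J-P(P3) «log band», BAND crux `XiDerivBandRealAllRates` of route
«JensenLogBand», line «band-one-window» (u-arc reshape), lead rh-jensen-prover g7 — step (b)/(c) of
the S4b recipe in HOME/rh-jensen-prover/g7-work/LINE-PLAN.md §8.4–8.5. RH-FREE (Γ-factor only).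
WHAT THIS IS NOT: nothing here bears on zeros of `ζ` or the truth of RH.

`norm_saddleDen2_le_sq`: on the right half-annulus (`Re(u−c) ≥ 0`, `|u−c| ≤ (6/5)h`),
`‖D″(u)‖ ≤ 25/(2·(0.58T)²) + 2/(0.58T)³ + 2(n+1)/(1.58T)³`, from the sharp
`‖λ‴(s) + 1/(2s²)‖ ≤ 12/(Im s)²` (`norm_deriv_lamPrime2_add_le_sq`). Consequently
`r³‖D″‖ ≤ 51·h·τ² + 0.7(n+1)τ³ = O(n)` uniformly down to the bottom of the band (`τ = h/T ≤ 0.35`,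
`h ≤ (n+1)/10`), which is what the cubic window remainder needs.
-/

noncomputable section

-- single-problem summit: `Summit.RiemannHypothesis.RiemannHypothesis.…` is the tree convention
set_option linter.dupNamespace false

open Complex Real Set

namespace Summit.RiemannHypothesis.RiemannHypothesis.Theorems.JensenPolynomials.LogBandArc

open Literature.NumberTheory.LFunctions

variable {n : ℕ} {x T : ℝ} {u : ℂ}

/-- **Sharp bound for `D″` on the right half-annulus:**
`‖D″(u)‖ ≤ 25/(2(0.58T)²) + 2/(0.58T)³ + 2(n+1)/(1.58T)³`. [folklore] -/
theorem norm_saddleDen2_le_sq (hx : |x| ≤ 1 / 2) (hT : 100 ≤ T) (hh : 1 / 2 ≤ bandRadius n T)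
    (hhT : bandRadius n T ≤ 7 / 20 * T) (hure : 0 ≤ (u - ((x : ℂ) + (T : ℂ) * I)).re)
    (hur : ‖u - ((x : ℂ) + (T : ℂ) * I)‖ ≤ 6 / 5 * bandRadius n T) :
    ‖saddleDen2 n ((x : ℂ) + (T : ℂ) * I) u‖ ≤
      25 / (2 * (29 / 50 * T) ^ 2) + 2 / (29 / 50 * T) ^ 3 + 2 * ((n : ℝ) + 1) / (79 / 50 * T) ^ 3 := by
  set c : ℂ := (x : ℂ) + (T : ℂ) * I with hc
  set s : ℂ := 1 / 2 + u with hs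
  obtain ⟨him_lo, -, hre_lo, -, hns_lo, -, hnu_lo, -, -, hnuc⟩ :=
    halfAnnulus_geometry hx hT hh hhT hure hur
  rw [← hc] at hnuc
  rw [← hs] at him_lo hre_lo hns_lo
  have hT0 : 0 < T := by linarith
  have hlam3 := norm_deriv_lamPrime2_add_le_sq (s := s) (by linarith) (by linarith)
  have h1 : ‖deriv lamPrime2 s‖ ≤ 25 / (2 * (29 / 50 * T) ^ 2) := by
    have hsplit : ‖deriv lamPrime2 s‖ ≤ ‖deriv lamPrime2 s + 1 / (2 * s ^ 2)‖ + ‖1 / (2 * s ^ 2)‖ := by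
      have := norm_sub_le (deriv lamPrime2 s + 1 / (2 * s ^ 2)) (1 / (2 * s ^ 2))
      rwa [add_sub_cancel_right] at this
    have ha : ‖1 / (2 * s ^ 2)‖ ≤ 1 / (2 * (29 / 50 * T) ^ 2) := by
      rw [norm_div, norm_one, norm_mul, Complex.norm_two, norm_pow]
      exact one_div_le_one_div_of_le (by positivity)
        (mul_le_mul_of_nonneg_left (pow_le_pow_left₀ (by positivity) hns_lo 2) (by norm_num))
    have hb : 12 / s.im ^ 2 ≤ 12 / (29 / 50 * T) ^ 2 :=
      div_le_div_of_nonneg_left (by norm_num) (by positivity) (pow_le_pow_left₀ (by positivity) him_lo 2)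
    have e : 25 / (2 * (29 / 50 * T) ^ 2) = 12 / (29 / 50 * T) ^ 2 + 1 / (2 * (29 / 50 * T) ^ 2) := by
      field_simp; ring
    rw [e]
    linarith
  have h2 : ‖(2 : ℂ) / u ^ 3‖ ≤ 2 / (29 / 50 * T) ^ 3 := by
    rw [norm_div, Complex.norm_two, norm_pow]
    exact div_le_div_of_nonneg_left (by norm_num) (by positivity) (pow_le_pow_left₀ (by positivity) hnu_lo 3)
  have h3 : ‖2 * ((n : ℂ) + 1) / (u + c) ^ 3‖ ≤ 2 * ((n : ℝ) + 1) / (79 / 50 * T) ^ 3 := by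
    rw [norm_div, norm_pow, norm_mul, Complex.norm_two]
    have hn1 : ‖(n : ℂ) + 1‖ = (n : ℝ) + 1 := by
      rw [show ((n : ℂ) + 1) = ((n + 1 : ℕ) : ℂ) by push_cast; ring, Complex.norm_natCast]; push_cast; ring
    rw [hn1]
    exact div_le_div_of_nonneg_left (by positivity) (by positivity) (pow_le_pow_left₀ (by positivity) hnuc 3)
  calc ‖saddleDen2 n c u‖
      = ‖deriv lamPrime2 s + 2 / u ^ 3 - 2 * ((n : ℂ) + 1) / (u + c) ^ 3‖ := by rw [saddleDen2]
    _ ≤ ‖deriv lamPrime2 s‖ + ‖(2 : ℂ) / u ^ 3‖ + ‖2 * ((n : ℂ) + 1) / (u + c) ^ 3‖ :=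
        norm_sub_le_of_le (norm_add_le _ _) le_rfl
    _ ≤ _ := by linarith

end Summit.RiemannHypothesis.RiemannHypothesis.Theorems.JensenPolynomials.LogBandArc

end
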